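import Literature.Probability.LatticeModels.PercolationRowEdgeOperators
import HarnessLib

/-!
# The `⋆`-free sector of the percolation row transfer matrix is absorbing

Companion to `PercolationRowTransfer.lean` (stochastic row-to-row transfer matrix `T_S` of bond
percolation on `ℤ²` at `p = 1/2`, route `CriticalPhenomena/CardyPolygonWords`). That file remarks,
without proof, that "no cemetery is needed because `⋆` is never deleted; a pattern in which no site is
joined to `⋆` simply stays such". Here this is proved, letter by letter: if no site of the row is joined
to the bottom arc `⋆` (the pattern is *`⋆`-free* — the zero-through-line / `h = 0` sector of the
Temperley–Lieb chain, in which the stationary distribution of `T_S` lives), then the same holds after the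
vertical layer, after every join generator / horizontal layer, after a full row step, and after the
junction maps (insertion and restriction of columns); consequently the transfer matrix has no entry from
a `⋆`-free pattern to a pattern with a site joined to `⋆`, and the read-out functional `β_S` vanishes on
`⋆`-free patterns (so the `⋆`-free mass of a word never contributes to a bottom-to-top crossing
amplitude). Folklore bookkeeping (Blöte–Nightingale 1982; Cardy, arXiv:math-ph/0103018, §7.1;
Bondesan–Jacobsen–Saleur, arXiv:1207.7005, §2); no single printed source states it as a lemma.

* `star_isolated_vertRel`, `star_isolated_joinRel`, `star_isolated_horizRel` (relation level);
* `RowState.starFree_rowStep`, `RowState.starFree_insertState`, `RowState.starFree_restrictState`;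
* `rowReadout_eq_zero_of_starFree`, `percolationRowTransfer_eq_zero_of_starFree`.

"`⋆`-free" is kept as the inline hypothesis `∀ x, ¬ π.JoinedToStar x` (no new definition).
-/

noncomputable section

open Finset
open scoped Classical

namespace Literature.Probability.LatticeModels

variable {S S' : Finset ℤ}

/-! ### Relation level: `⋆` stays isolated from the sites -/

/-- The vertical layer does not join any site to `⋆` if none was. [folklore] -/
theorem star_isolated_vertRel (O : Finset S) {π : Setoid (RowPoint S)}
    (hπ : ∀ x : S, ¬ π (Sum.inl x) (RowPoint.star S)) (x : S) :
    ¬ vertRel O π (Sum.inl x) (RowPoint.star S) := by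
  rw [vertRel_apply]
  rintro (h | ⟨-, -, h⟩)
  · exact Sum.inl_ne_inr h
  · exact hπ x h

/-- A join generator (one open horizontal bond) does not join any site to `⋆` if none was. [folklore] -/
theorem star_isolated_joinRel (y : S) {π : Setoid (RowPoint S)}
    (hπ : ∀ x : S, ¬ π (Sum.inl x) (RowPoint.star S)) (x : S) :
    ¬ joinRel y π (Sum.inl x) (RowPoint.star S) := by
  by_cases h : (y : ℤ) + 1 ∈ S
  · rw [joinRel_apply y h]
    rintro (h0 | ⟨-, h1 | h1⟩)
    · exact hπ x h0
    · exact hπ y (π.symm h1)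
    · exact hπ ⟨(y : ℤ) + 1, h⟩ (π.symm h1)
  · rw [joinRel_of_not_mem y h]
    exact hπ x

/-- The horizontal layer does not join any site to `⋆` if none was. [folklore] -/
theorem star_isolated_horizRel (H : Finset S) {π : Setoid (RowPoint S)}
    (hπ : ∀ x : S, ¬ π (Sum.inl x) (RowPoint.star S)) (x : S) :
    ¬ horizRel H π (Sum.inl x) (RowPoint.star S) := by
  induction H using Finset.induction_on generalizing x with
  | empty =>
    rw [horizRel_empty]
    exact hπ x
  | insert y H _ ih =>
    rw [horizRel_insert]
    exact star_isolated_joinRel y ih x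

/-- Insertion of columns does not join any site to `⋆` if none was. [folklore] -/
theorem star_isolated_insertRel (h : S ⊆ S') {π : Setoid (RowPoint S)}
    (hπ : ∀ x : S, ¬ π (Sum.inl x) (RowPoint.star S)) (x : S') :
    ¬ insertRel h π (Sum.inl x) (RowPoint.star S') := by
  rintro (h0 | ⟨a', b', ha, hb, hab⟩)
  · exact Sum.inl_ne_inr h0
  · rcases a' with xa | ua
    · rcases b' with xb | ub
      · simp [RowPoint.incl, RowPoint.star] at hb
      · exact hπ xa hab
    · simp [RowPoint.incl] at ha

/-- Restriction of columns does not join any site to `⋆` if none was. [folklore] -/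
theorem star_isolated_restrictRel (h : S ⊆ S') {π' : Setoid (RowPoint S')}
    (hπ' : ∀ x : S', ¬ π' (Sum.inl x) (RowPoint.star S')) (x : S) :
    ¬ restrictRel h π' (Sum.inl x) (RowPoint.star S) := by
  rw [restrictRel, Setoid.comap_rel]
  exact hπ' ⟨x, h x.2⟩

/-! ### State level: the `⋆`-free sector is absorbing -/

namespace RowState

/-- **One row of percolation keeps a `⋆`-free pattern `⋆`-free** ("a pattern in which no site is
joined to `⋆` simply stays such"). [folklore] -/
theorem starFree_rowStep {π : RowState S} (hπ : ∀ x : S, ¬ π.JoinedToStar x) (O H : Finset S)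
    (x : S) : ¬ (rowStep O H π).JoinedToStar x :=
  star_isolated_horizRel H (star_isolated_vertRel O hπ) x

/-- The detach generator keeps a `⋆`-free pattern `⋆`-free. [folklore] -/
theorem starFree_detach {π : RowState S} (hπ : ∀ x : S, ¬ π.JoinedToStar x) (y x : S) :
    ¬ (π.detach y).JoinedToStar x :=
  star_isolated_vertRel _ hπ x

/-- The join generator keeps a `⋆`-free pattern `⋆`-free. [folklore] -/
theorem starFree_join {π : RowState S} (hπ : ∀ x : S, ¬ π.JoinedToStar x) (y x : S) :
    ¬ (π.join y).JoinedToStar x :=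
  star_isolated_joinRel y hπ x

/-- Inserting columns keeps a `⋆`-free pattern `⋆`-free. [folklore] -/
theorem starFree_insertState (h : S ⊆ S') {π : RowState S} (hπ : ∀ x : S, ¬ π.JoinedToStar x)
    (x : S') : ¬ (insertState h π).JoinedToStar x :=
  star_isolated_insertRel h hπ x

/-- Restricting columns keeps a `⋆`-free pattern `⋆`-free. [folklore] -/
theorem starFree_restrictState (h : S ⊆ S') {π' : RowState S'}
    (hπ' : ∀ x : S', ¬ π'.JoinedToStar x) (x : S) : ¬ (restrictState h π').JoinedToStar x :=
  star_isolated_restrictRel h hπ' x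

/-- The totally disconnected state is `⋆`-free. [folklore] -/
theorem starFree_free (S : Finset ℤ) (x : S) : ¬ (free S).JoinedToStar x := by
  intro h
  have h' : (⊥ : Setoid (RowPoint S)) (Sum.inl x) (RowPoint.star S) := h
  rw [Setoid.bot_def] at h'
  exact Sum.inl_ne_inr h'

end RowState

/-- **The read-out functional vanishes on the `⋆`-free sector**: a `⋆`-free row carries no
bottom-to-top crossing. [cite: Cardy2001, §7.1] -/
theorem rowReadout_eq_zero_of_starFree {π : RowState S} (hπ : ∀ x : S, ¬ π.JoinedToStar x) :
    rowReadout S π = 0 := by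
  unfold rowReadout
  rw [if_neg (not_exists.mpr hπ)]

/-- **The `⋆`-free sector is absorbing for `T_S`**: the transfer matrix has no entry from a
`⋆`-free pattern to a pattern in which some site is joined to `⋆`. [cite: BondesanJacobsenSaleur2012, §2] -/
theorem percolationRowTransfer_eq_zero_of_starFree {π π' : RowState S}
    (hπ : ∀ x : S, ¬ π.JoinedToStar x) (hπ' : ∃ x : S, π'.JoinedToStar x) :
    PercolationRowTransfer S π π' = 0 := by
  unfold PercolationRowTransfer
  rw [Finset.card_eq_zero.mpr, Nat.cast_zero, zero_div]
  rw [Finset.filter_eq_empty_iff]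
  rintro ⟨O, H⟩ - hOH
  obtain ⟨x, hx⟩ := hπ'
  rw [← hOH] at hx
  exact RowState.starFree_rowStep hπ O H x hx

/-- Hence a `⋆`-free distribution stays `⋆`-free under the transfer step: if `μ` vanishes off the
`⋆`-free sector, so does `μ ᵥ* T_S`. [cite: BondesanJacobsenSaleur2012, §2] -/
theorem transferLin_apply_eq_zero_of_starFree {μ : RowState S → ℝ}
    (hμ : ∀ π : RowState S, (∃ x : S, π.JoinedToStar x) → μ π = 0) {π' : RowState S}
    (hπ' : ∃ x : S, π'.JoinedToStar x) : transferLin S μ π' = 0 := by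
  simp only [transferLin, Matrix.vecMulLinear_apply, Matrix.vecMul, dotProduct]
  refine Finset.sum_eq_zero fun π _ => ?_
  by_cases h : ∃ x : S, π.JoinedToStar x
  · rw [hμ π h, zero_mul]
  · rw [percolationRowTransfer_eq_zero_of_starFree (not_exists.mp h) hπ', mul_zero]

end Literature.Probability.LatticeModels

end
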